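import Summits.BirchSwinnertonDyer.BirchSwinnertonDyer.Theorems.GenusKolyvaginAtTwoPowDvdShaCardAtTwoRTExactEigenFunctionalLaw
import Summits.BirchSwinnertonDyer.BirchSwinnertonDyer.Theorems.KolyvaginRankRigidityAtTwoSwapPairingLowerBoundGlobal
import HarnessLib

/-!
# Route `GenusKolyvaginAtTwo`, crux L_T `PowDvdShaCardAtTwoRT` (stmt-BirchSwinnertonDyer-23242), LINE 18 stub KS, the DROPS (exact UP-swap) —
# SOCKET `hP7a` OF LEAD's `…RTExactSwapCore`, VERBATIM: the EXACT Kummer-side lower bound of the swap pairing at the fresh prime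
# (`2^(a+b−M) • ⟨loc_v w, loc_v (w_* C)⟩_v ≠ 0`), one bit sharper than KRR's P7a

Seat `bsd-line-gk2-p3` g23 (PROVER seat 3/3, cell `bsd-f1-sign2`), `--supports stmt-BirchSwinnertonDyer-23242` (helper; closes nothing).
THEOREMS ONLY (no definition, no named fact, no `sorry`).  BSD is NOT proved by any of this; neither is the crux nor any stub.

WHAT.  `swapPairing_pow_smul_ne_zero_at_two_exact` — the hypothesis `hP7a` of `PlusDescent.exactSwap_core` (LEAD gk2-p1 g18, p727522) with
ITS TEXT VERBATIM (after the frame: `K` imaginary quadratic, `Δ < 0`, `τ ≠ 1`, `τ² = 1`, a `τ`-equivariant Weil datum per level `hτe`,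
injective `τ`-compatible invariant maps `hinj`/`hinvc` — KRR's hybrid-frame inputs plus `Δ < 0`): for a fresh Zhang–Kolyvagin prime `ℓ` at `2`
with `M ≤ M(ℓ)` and `FrobEqFrobInfty W K (2^{M'}) ℓ` (`M ≤ M'`), its place `v`, global `s`-eigenclasses `w, C` with `loc_v w` Kummer,
`2^a loc_v w ≠ 0`, `2^b loc_v C ∉ Kum_v` and `M ≤ a + b`: **`2^(a+b−M) • ⟨loc_v w, loc_v(w_* C)⟩_v ≠ 0`**.

HOW.  KRR's global reduction `KolyvaginLowerBoundAtTwo.swapPairing_pow_smul_ne_zero_at_two` (krr2-p2, `…SwapPairingLowerBoundGlobal`) COPIED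
VERBATIM (bookkeeping `loc ∘ conjAct = conjActPlace ∘ loc`, `conjActPlaceDual`, `map_weilDual_conjAct`, `localTatePairingZMod_conjActPlace`,
`dualTransported_kummerSelmerStructure_inr`), with its last step — the lossy local estimate `kummer_eval_pow_smul_ne_zero_at_two` (the
`s`-eigenpart of `Kum_v` is `ℤg + 2-torsion` for general `Δ`) — replaced by this seat's EXACT local law
`kummer_eigenFunctional_pow_smul_ne_zero_at_two` (`…RTExactEigenFunctionalLaw`: on `Δ < 0` the eigenparts are cyclic, one bit exactly).

References: [Kolyvagin1991MathAnn] §2 (proof of Thm. 2.2); [Jetchev2008] §3.2 (2)–(3), Prop. 4.2, §5 Thm. 5.1; [MilneADT2006] I Cor. 3.4;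
[McCallumLMS1991] §5 Lemma 5.3 and (13).
-/

set_option autoImplicit false
-- the Theorems namespace of this sub repeats the summit name by design (D-0017 nested layout)
set_option linter.dupNamespace false

noncomputable section

open scoped Classical
open Function NumberField IsDedekindDomain WeierstrassCurve Field
open Literature.NumberTheory.EllipticCurves Literature.NumberTheory.GaloisRepresentations
open Literature.NumberTheory.GaloisCohomology
open Literature.NumberTheory.GaloisRepresentations.DiscreteGaloisModule (localTatePairingZMod tateDual
  SelmerStructure)
open Summit.BirchSwinnertonDyer.Rank1Residual
open Summit.BirchSwinnertonDyer.Rank1Residual.JET.GlobalDuality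
open Summit.BirchSwinnertonDyer.BirchSwinnertonDyer.Theorems.KolyvaginLowerBoundAtTwo

namespace Summit.BirchSwinnertonDyer.BirchSwinnertonDyer.Theorems.GenusExact.PlusDescent

variable {K : Type} [Field K] [NumberField K] (W : WeierstrassCurve ℚ) [W.IsElliptic]
  [W.IsGloballyMinimal] [(W.baseChange K).IsElliptic]
  [∀ M : ℕ, NeZero (2 ^ M)] [∀ M : ℕ, Finite (geomTorsion (W.baseChange K) ((2 ^ M : ℕ) : ℤ))]
  (τ : K ≃ₐ[ℚ] K)
  (e : ∀ M : ℕ, geomTorsion (W.baseChange K) ((2 ^ M : ℕ) : ℤ) →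
    geomTorsion (W.baseChange K) ((2 ^ M : ℕ) : ℤ) → AlgebraicClosure K)
  (hμ : ∀ M S T, e M S T ^ (2 ^ M) = 1)
  (hadd₁ : ∀ M S₁ S₂ T, e M (S₁ + S₂) T = e M S₁ T * e M S₂ T)
  (hadd₂ : ∀ M S T₁ T₂, e M S (T₁ + T₂) = e M S T₁ * e M S T₂)
  (hgal : ∀ M (g : absoluteGaloisGroup K) (S T : geomTorsion (W.baseChange K) ((2 ^ M : ℕ) : ℤ)),
    g • e M S T = e M (g • S) (g • T))
  (halt : ∀ M T, e M T T = 1) (hnondeg : ∀ M T, (∀ S, e M S T = 1) → T = 0)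
  (inv : ∀ M : ℕ, LocalInvariants K (2 ^ M))

include halt hnondeg in
/-- **SOCKET `hP7a` of `PlusDescent.exactSwap_core`, EXACT (one bit sharper than KRR's P7a).**  For a fresh Kolyvagin prime `ℓ` at `2` of
index `≥ M` with `Frob_ℓ = Frob_∞` in `Gal(K(E[2^{M'}])/ℚ)` (`M ≤ M'`), its place `v`, global classes `w`, `C` in the `s`-eigenspaces of
`τ`, `loc_v w` Kummer with `2^a loc_v w ≠ 0`, and `2^b loc_v C ∉ Kum_v`, the local pairing `π = ⟨loc_v w, loc_v (w_* C)⟩_v` satisfies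
`2^{a+b−M} π ≠ 0` once `M ≤ a + b` (frame: `Δ < 0`).  [cite: Kolyvagin1991MathAnn, §2 (proof of Thm. 2.2)]
[cite: Jetchev2008, §3.2 (2)–(3), Prop. 4.2, §5 Thm. 5.1] [cite: MilneADT2006, Ch. I, Cor. 3.4] -/
theorem swapPairing_pow_smul_ne_zero_at_two_exact (hK : IsImaginaryQuadratic K) (hΔ : W.Δ < 0) (hτ1 : τ ≠ 1)
    (hττ : τ * τ = 1)
    (hτe : ∀ (M : ℕ) S T, liftAut τ (e M S T) =
      e M ((isLiftOfAut_liftAut τ).torsionMap W ((2 ^ M : ℕ) : ℤ) S)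
        ((isLiftOfAut_liftAut τ).torsionMap W ((2 ^ M : ℕ) : ℤ) T))
    (hinj : ∀ (M : ℕ) (v : HeightOneSpectrum (𝓞 K)), Injective (inv M (Sum.inr v)))
    (hinvc : ∀ M : ℕ, (inv M).IsConjCompatible τ) :
    ∀ (M M' ℓ : ℕ) (v : HeightOneSpectrum (𝓞 K))
      (w C : galoisCohomology ((W.baseChange K).torsionGaloisModule ((2 ^ M : ℕ) : ℤ)) 1) (s : ℤ) (a b : ℕ),
      (s = 1 ∨ s = -1) → Zhang2014.IsKolyvaginPrime (W.conductorNorm ℤ) W K 2 ℓ →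
      M ≤ Zhang2014.kolyvaginIndex W 2 ℓ → M ≤ M' → FrobEqFrobInfty W K (2 ^ M') ℓ →
      ((ℓ : ℕ) : 𝓞 K) ∈ v.asIdeal →
      conjAct W τ ((2 ^ M : ℕ) : ℤ) w = s • w → conjAct W τ ((2 ^ M : ℕ) : ℤ) C = s • C →
      galoisCohomology.localization ((W.baseChange K).torsionGaloisModule ((2 ^ M : ℕ) : ℤ)) (Sum.inr v) 1 w ∈
        (W.baseChange K).kummerSelmerStructure ((2 ^ M : ℕ) : ℤ) (Sum.inr v) →
      ((2 ^ a : ℕ) : ℤ) • galoisCohomology.localization ((W.baseChange K).torsionGaloisModule ((2 ^ M : ℕ) : ℤ))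
        (Sum.inr v) 1 w ≠ 0 →
      ((2 ^ b : ℕ) : ℤ) • galoisCohomology.localization ((W.baseChange K).torsionGaloisModule ((2 ^ M : ℕ) : ℤ))
        (Sum.inr v) 1 C ∉ (W.baseChange K).kummerSelmerStructure ((2 ^ M : ℕ) : ℤ) (Sum.inr v) →
      M ≤ a + b →
      (2 ^ (a + b - M) : ℕ) •
        localTatePairingZMod ((W.baseChange K).torsionGaloisModule ((2 ^ M : ℕ) : ℤ)) (2 ^ M) (Sum.inr v)
          (inv M (Sum.inr v))
          (galoisCohomology.localization ((W.baseChange K).torsionGaloisModule ((2 ^ M : ℕ) : ℤ)) (Sum.inr v) 1 w)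
          (galoisCohomology.localization (((W.baseChange K).torsionGaloisModule ((2 ^ M : ℕ) : ℤ)).tateDual (2 ^ M))
            (Sum.inr v) 1
            (galoisCohomology.map (weilDualIntertwining (W.baseChange K) (2 ^ M) (e M) (hμ M) (hadd₁ M) (hadd₂ M)
              (hgal M)) 1 C)) ≠ 0 := by
  -- (adapted from KRR `KolyvaginLowerBoundAtTwo.swapPairing_pow_smul_ne_zero_at_two`, Theorems/KolyvaginRankRigidityAtTwoSwapPairingLowerBoundGlobal.lean)
  intro M M' ℓ v w C s a b hs hKol hMℓ hMM' hF hv hwτ hCτ hwK hwa hCb hab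
  classical
  haveI : Fact (Nat.Prime 2) := ⟨Nat.prime_two⟩
  haveI : CharZero (v.adicCompletion K) :=
    charZero_of_injective_algebraMap (algebraMap K (v.adicCompletion K)).injective
  have hℓ0 : ℓ ≠ 0 := hKol.1.ne_zero
  have hfix : τ • v = v := smul_place_eq_self_of_natCast_mem τ hℓ0 hKol.2.2.2.2.1 v hv
  have e2 : ∀ n : ℕ, ((2 ^ n : ℕ) : ℤ) = (2 : ℤ) ^ n := fun n ↦ by norm_num
  -- `2^M` kills the local `H¹` and the values
  have hMtor : ∀ P : geomTorsion (W.baseChange K) ((2 ^ M : ℕ) : ℤ), (2 ^ M) • P = 0 := fun P ↦ by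
    simpa using (W.baseChange K).natAbs_nsmul_geomTorsion P
  have hkill : ∀ c : galoisCohomology
      (((W.baseChange K).torsionGaloisModule ((2 ^ M : ℕ) : ℤ)).toLocal (Sum.inr v : Place K)) 1,
      (2 : ℤ) ^ M • c = 0 := fun c ↦ by
    have h := galoisCohomology.nsmul_eq_zero_of_forall
      (((W.baseChange K).torsionGaloisModule ((2 ^ M : ℕ) : ℤ)).toLocal (Sum.inr v : Place K)) hMtor c
    exact ((congrArg (fun z : ℤ ↦ z • c) (e2 M)).symm.trans (natCast_zsmul c (2 ^ M))).trans h
  have hC : ∀ c : ZMod (2 ^ M), (2 : ℤ) ^ M • c = 0 := fun c ↦ by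
    rw [← e2, natCast_zsmul, nsmul_eq_mul, ZMod.natCast_self, zero_mul]
  -- `M ≥ 1` (at `M = 0` the local `H¹` vanishes)
  have hM1 : 1 ≤ M := by
    rcases Nat.eq_zero_or_pos M with h0 | h
    · exfalso
      subst h0
      apply hwa
      have h1 := hkill (galoisCohomology.localization
        ((W.baseChange K).torsionGaloisModule ((2 ^ 0 : ℕ) : ℤ)) (Sum.inr v) 1 w)
      rw [show ((2 : ℤ) ^ 0) = 1 from pow_zero _, one_smul] at h1
      rw [h1, smul_zero]
    · exact h
  have hNpow : IsPrimePow (2 ^ M) := ⟨2, M, Nat.prime_two.prime, hM1, rfl⟩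
  -- the Kummer class `x = loc_v w` is an `s`-eigenclass of `σ_*`
  have hx : conjActPlace W τ ((2 ^ M : ℕ) : ℤ) hfix
      (galoisCohomology.localization ((W.baseChange K).torsionGaloisModule ((2 ^ M : ℕ) : ℤ)) (Sum.inr v) 1 w) =
      s • galoisCohomology.localization ((W.baseChange K).torsionGaloisModule ((2 ^ M : ℕ) : ℤ))
        (Sum.inr v) 1 w := by
    rw [conjActPlace_localization, hwτ, map_zsmul]
  -- the dual class `y = loc_v (w_* C)` is an `s`-eigenclass of `σ_*`
  set y := galoisCohomology.localization
      (((W.baseChange K).torsionGaloisModule ((2 ^ M : ℕ) : ℤ)).tateDual (2 ^ M)) (Sum.inr v) 1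
      (galoisCohomology.map (weilDualIntertwining (W.baseChange K) (2 ^ M) (e M) (hμ M) (hadd₁ M) (hadd₂ M)
        (hgal M)) 1 C) with hy
  have hyτ : conjActPlaceDual W τ ((2 ^ M : ℕ) : ℤ) (2 ^ M) hfix y = s • y := by
    rw [hy, conjActPlaceDual_localization,
      ← map_weilDual_conjAct W τ (2 ^ M) (e M) (hμ M) (hadd₁ M) (hadd₂ M) (hgal M) (hτe M) C, hCτ,
      map_zsmul, map_zsmul]
  -- the functional `Φ = ⟨·, y⟩_v` and its `τ`-variance on `Kum_v`
  set P := localTatePairingZMod ((W.baseChange K).torsionGaloisModule ((2 ^ M : ℕ) : ℤ)) (2 ^ M)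
      (Sum.inr v : Place K) (inv M (Sum.inr v)) with hP
  have hΦ : ∀ a' ∈ (W.baseChange K).kummerSelmerStructure ((2 ^ M : ℕ) : ℤ) (Sum.inr v : Place K),
      P.flip y (conjActPlace W τ ((2 ^ M : ℕ) : ℤ) hfix a') = s • P.flip y a' := by
    intro a' _
    simp only [AddMonoidHom.flip_apply]
    have h1 := localTatePairingZMod_conjActPlace W τ ((2 ^ M : ℕ) : ℤ) (N := 2 ^ M) (inv M) (hinvc M) hfix
      (conjActPlace W τ ((2 ^ M : ℕ) : ℤ) hfix a') y
    rw [conjActPlace_conjActPlace W τ ((2 ^ M : ℕ) : ℤ) hττ hfix hfix a', hyτ, map_zsmul] at h1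
    rw [hP]
    exact h1.symm
  -- the inputs of the local estimate
  have hi : (2 : ℤ) ^ a • galoisCohomology.localization
      ((W.baseChange K).torsionGaloisModule ((2 ^ M : ℕ) : ℤ)) (Sum.inr v) 1 w ≠ 0 := by
    rw [← e2]; exact hwa
  have hj : ∃ a' ∈ (W.baseChange K).kummerSelmerStructure ((2 ^ M : ℕ) : ℤ) (Sum.inr v : Place K),
      (2 : ℤ) ^ b • P.flip y a' ≠ 0 := by
    by_contra hcon
    push Not at hcon
    apply hCb
    have hsd := GaloisImage.dualTransported_kummerSelmerStructure_inr (W.baseChange K) (2 ^ M) (e M) (hμ M)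
      (hadd₁ M) (hadd₂ M) (hgal M) (halt M) (hnondeg M) hNpow v
      (localEulerPoincareCharacteristic_holds (v.adicCompletion K)) (inv M) (hinj M v)
    rw [← hsd, GaloisImage.mem_dualTransported_weilDual_iff]
    intro a' ha'
    have h0 := hcon a' ha'
    rw [← X11b.LocBridge.localTatePairingZMod_map_weilDual]
    have hnat : galoisCohomology.map ((weilDualIntertwining (W.baseChange K) (2 ^ M) (e M) (hμ M) (hadd₁ M)
        (hadd₂ M) (hgal M)).restrictField (Place.Completion (Sum.inr v : Place K))) 1
        (galoisCohomology.localization ((W.baseChange K).torsionGaloisModule ((2 ^ M : ℕ) : ℤ))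
          (Sum.inr v) 1 C) = y := by
      rw [hy]
      exact (galoisCohomology.res_map_one _ _ C).symm
    have hmap : galoisCohomology.map ((weilDualIntertwining (W.baseChange K) (2 ^ M) (e M) (hμ M) (hadd₁ M)
        (hadd₂ M) (hgal M)).restrictField (Place.Completion (Sum.inr v : Place K))) 1
        (((2 ^ b : ℕ) : ℤ) • galoisCohomology.localization ((W.baseChange K).torsionGaloisModule ((2 ^ M : ℕ) : ℤ))
          (Sum.inr v) 1 C) = ((2 ^ b : ℕ) : ℤ) • y :=
      (map_zsmul (galoisCohomology.map ((weilDualIntertwining (W.baseChange K) (2 ^ M) (e M) (hμ M) (hadd₁ M)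
        (hadd₂ M) (hgal M)).restrictField (Place.Completion (Sum.inr v : Place K))) 1) _ _).trans
        (congrArg (fun z ↦ ((2 ^ b : ℕ) : ℤ) • z) hnat)
    rw [hmap, map_zsmul (P a') _ y, e2 b]
    simpa only [AddMonoidHom.flip_apply] using h0
  -- (everything above: KRR `swapPairing_pow_smul_ne_zero_at_two`, verbatim; the last step is the EXACT local law)
  have key := kummer_eigenFunctional_pow_smul_ne_zero_at_two W K hK hΔ hM1 hKol hMℓ hF hMM' v hv hτ1 hfix hs hC
    (P.flip y) hΦ hwK hx hi hj hab
  -- back to the `ℕ`-scalar statement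
  intro h
  apply key
  rw [AddMonoidHom.flip_apply, ← e2, natCast_zsmul]
  exact h

end Summit.BirchSwinnertonDyer.BirchSwinnertonDyer.Theorems.GenusExact.PlusDescent

end
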